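import Summits.ABC.ABC.Theorems.CongruentialReceptacleTameLocalReceptacleCellLaws2Defs
import Summits.ABC.ABC.Theorems.CongruentialReceptacleTameLocalReceptacleStubKeyCellsOfCellLaws

/-!
# Crux `TameLocalReceptacle` (stmt-ABC-14354), line `grh-friable-cell-resolution`:
# engine output with logarithmic size interface ⇒ key-cell structure

Registered stub `stub_keyCells_of_cellLawsLog : CellLawsPackage₂ (1/4) → TiltBound → KeyCellStructure (1/4)` of the
checked skeleton `Cruxes/TameLocalReceptacle/Lines/grh_friable_cell_resolution.lean` (v6, lead
`prover-line-stmt-ABC-14354-a1-0`).  The same finite-sum bookkeeping as the landed `stub_keyCells_of_cellLaws`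
(`…StubKeyCellsOfCellLaws.lean`, lemmas `CellLawsBook.*`, reused here), for the interface `CellLawsPackage₂` of
`…CellLaws2Defs.lean`: the shallow laws come with their own precision `e₁ ∈ (0, 1/2]`, the member sizes with
`log c ≤ Lc` (`LogSizeClause`), linked only by `e₁ · Lc ≤ A₀`; the tails come with the freely prescribed `e`.
* `sizeClause_of_logSizeClause`: `LogSizeClause Lc F → SizeClause Lc 1 F`, so that `CellLawsBook.weighted_cellMass_le`
  gives `Σ_{q,v} keyWeight·cellMass ≤ 6 Lc`.
* `err_sum_le₂` / `ce_bound₂` / `vm_bound₂`: the template's cell-error sum, (CE) and (VM) bounds with split precisions —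
  `Σ keyWeight·E ≤ 12 e₁ Lc + e`, `classDiscrepancy ≤ 24 e₁ Lc + 2e`, `valuationDiscrepancy ≤ 24 e₁ Lc + 2e + C_T`.
* The stub: tails `e := 1`, depth `max N₁ (⌈2 C_T/δ⌉₊ + ⌈(48 A₀ + 4)/δ⌉₊)`, so that `24 e₁ Lc + 2 + C_T ≤ 24 A₀ + 2 + C_T ≤ δ N`;
  families and shape clauses verbatim.
-/

-- `Summit.<Summit>.<Problem>` is the mandated summit-side namespace (CONVENTIONS §2); for the
-- single-conjunct summit `ABC` the two coincide, so the duplicate `ABC.ABC` is deliberate.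
set_option linter.dupNamespace false

noncomputable section

namespace Summit.ABC.ABC.Theorems.TameLocalReceptacle

open Finset Literature.NumberTheory.DiophantineGeometry KeyCellBook CellLawsBook

namespace CellLawsBook

/-! ### Logarithmic size and the split-precision cell-error sum -/

/-- A logarithmic size bound `log c ≤ Lc` is the size clause `c ≤ exp(Lc · 1)` (`c ≤ exp (log c)`). [folklore] -/
theorem sizeClause_of_logSizeClause {Lc : ℝ} {F : Finset (ℕ × ℕ × ℕ)} (h : LogSizeClause Lc F) :
    SizeClause Lc 1 F := fun T hT =>
  (Real.le_exp_log _).trans (by rw [Nat.cast_one, mul_one]; exact Real.exp_le_exp.2 (h T hT))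

/-- The total weighted cell error of a family obeying the cell laws with SPLIT precisions (nonempty, abc-triples,
`log c ≤ Lc`, friable members, vanishing inadmissible classes, shallow law with precision `e₁ ≤ 1/2` and exponents
`(a_A, a_B, a_C)`, tail `≤ e`), for the model values of `CellLawsBook.cell_err_le`:
`Σ_{q,v} keyWeight·E ≤ 2e₁·6Lc + e`. [folklore] -/
theorem err_sum_le₂ {F : Finset (ℕ × ℕ × ℕ)} {e₁ e Lc aA aB aC : ℝ} {yb Y : ℕ} (he0 : 0 ≤ e₁) (he : e₁ ≤ 1 / 2)
    (hF : F.Nonempty ∧ (∀ T ∈ F, IsABCTriple T.1 T.2.1 T.2.2) ∧ LogSizeClause Lc F ∧ FriableMembers yb F ∧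
      InadmissibleVanish F ∧ ShallowLaw e₁ yb Y aA aB aC F ∧ TailSmall e Y F) (P : Pos) (Q V : ℕ) :
    ∑ q ∈ oddPrimesBelow Q, ∑ v ∈ Icc 1 V, keyWeight (P.exps v) q *
        (∑ r ∈ range q, ∑ s ∈ range q, ∑ z ∈ range q, |intensity F P q (mkDatum (Pos.exps P v) r s z) - ite (Pos.adm P q r s z = true) ((if q ≤ yb ∧ q ^ (v + 1) ≤ Y then cellModel aA aB aC P q v else 0)) (0 : ℝ)|) ≤
      12 * e₁ * Lc + e := by
  obtain ⟨hF0, habc, hS, hfr, hIV, hSL, hTl⟩ := hF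
  calc _ ≤ ∑ q ∈ oddPrimesBelow Q, ∑ v ∈ Icc 1 V, (2 * e₁ * (keyWeight (P.exps v) q * cellMass F P q v) +
          (if q ^ (v + 1) ≤ Y then 0 else keyWeight (P.exps v) q * cellMass F P q v)) :=
        Finset.sum_le_sum fun q hq => Finset.sum_le_sum fun v hv => by
          have hqp := prime_of_mem_oddPrimesBelow hq
          have hq2 : q ≠ 2 := (Finset.mem_filter.1 hq).2.2
          have hv1 : 1 ≤ v := (Finset.mem_Icc.1 hv).1
          exact cell_err_le F P hqp v he0 he (fun r s z h => hIV P q v r s z hqp hq2 hv1 h)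
            (fun hyb hY r s z h => hSL P q v r s z hqp hq2 hyb hv1 hY h)
            (fun hyb => cellMass_eq_zero_of_lt habc hfr hyb P v)
    _ ≤ 12 * e₁ * Lc + e := by
        simp only [Finset.sum_add_distrib, ← Finset.mul_sum]
        have hW := weighted_cellMass_le P hF0 habc (sizeClause_of_logSizeClause hS) Q V
        rw [Nat.cast_one, mul_one] at hW
        linarith [hTl P Q V, mul_le_mul_of_nonneg_left hW (by positivity : (0 : ℝ) ≤ 2 * e₁)]

/-- **(CE), logarithmic interface** `classDiscrepancy ≤ 24e₁Lc + 2e` (`CellLawsBook.ce_cell_le` with the model values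
of `err_sum_le₂`). [folklore] -/
theorem ce_bound₂ {F : Finset (ℕ × ℕ × ℕ)} {e₁ e Lc aA aB aC : ℝ} {yb Y : ℕ} (he0 : 0 ≤ e₁) (he : e₁ ≤ 1 / 2)
    (hF : F.Nonempty ∧ (∀ T ∈ F, IsABCTriple T.1 T.2.1 T.2.2) ∧ LogSizeClause Lc F ∧ FriableMembers yb F ∧
      InadmissibleVanish F ∧ ShallowLaw e₁ yb Y aA aB aC F ∧ TailSmall e Y F) (P : Pos) (Q V : ℕ) :
    classDiscrepancy F P Q V ≤ 24 * e₁ * Lc + 2 * e := by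
  unfold classDiscrepancy
  calc _ ≤ ∑ q ∈ oddPrimesBelow Q, ∑ v ∈ Icc 1 V, 2 * (keyWeight (P.exps v) q *
          (∑ r ∈ range q, ∑ s ∈ range q, ∑ z ∈ range q, |intensity F P q (mkDatum (Pos.exps P v) r s z) - ite (Pos.adm P q r s z = true) ((if q ≤ yb ∧ q ^ (v + 1) ≤ Y then cellModel aA aB aC P q v else 0)) (0 : ℝ)|)) :=
        Finset.sum_le_sum fun q hq => Finset.sum_le_sum fun v _ =>
          ce_cell_le F P (prime_of_mem_oddPrimesBelow hq) v _
    _ ≤ 24 * e₁ * Lc + 2 * e := by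
        simp only [← Finset.mul_sum]
        linarith [err_sum_le₂ he0 he hF P Q V]

/-- **(VM), logarithmic interface** for a compared pair: `valuationDiscrepancy ≤ 24e₁Lc + 2e + C`, where `C` bounds the
tilt `Σ keyWeight·(q−1)²·|m_F − m_G|` of the two local models (supplied by `TiltBound`): per cell
`|cm_F − cm_G| ≤ E_F + (q−1)²|m⋆_F − m⋆_G| + E_G` for the model values `m⋆` of `CellLawsBook.cell_err_le`. [folklore] -/
theorem vm_bound₂ {F G : Finset (ℕ × ℕ × ℕ)} {e₁ e Lc aA aB aC aA' aB' aC' C : ℝ} {yb Y : ℕ} (he0 : 0 ≤ e₁)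
    (he : e₁ ≤ 1 / 2)
    (hF : F.Nonempty ∧ (∀ T ∈ F, IsABCTriple T.1 T.2.1 T.2.2) ∧ LogSizeClause Lc F ∧ FriableMembers yb F ∧
      InadmissibleVanish F ∧ ShallowLaw e₁ yb Y aA aB aC F ∧ TailSmall e Y F)
    (hG : G.Nonempty ∧ (∀ T ∈ G, IsABCTriple T.1 T.2.1 T.2.2) ∧ LogSizeClause Lc G ∧ FriableMembers yb G ∧
      InadmissibleVanish G ∧ ShallowLaw e₁ yb Y aA' aB' aC' G ∧ TailSmall e Y G) (P : Pos) (Q V : ℕ)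
    (hC : ∑ q ∈ oddPrimesBelow Q, ∑ v ∈ Icc 1 V, keyWeight (P.exps v) q *
      ((((q : ℝ) - 1) ^ 2) * |cellModel aA aB aC P q v - cellModel aA' aB' aC' P q v|) ≤ C) :
    valuationDiscrepancy F G P Q V ≤ 24 * e₁ * Lc + 2 * e + C := by
  have h1 := err_sum_le₂ he0 he hF P Q V
  have h2 := err_sum_le₂ he0 he hG P Q V
  unfold valuationDiscrepancy
  calc _ ≤ ∑ q ∈ oddPrimesBelow Q, ∑ v ∈ Icc 1 V, (keyWeight (P.exps v) q *
          (∑ r ∈ range q, ∑ s ∈ range q, ∑ z ∈ range q, |intensity F P q (mkDatum (Pos.exps P v) r s z) - ite (Pos.adm P q r s z = true) ((if q ≤ yb ∧ q ^ (v + 1) ≤ Y then cellModel aA aB aC P q v else 0)) (0 : ℝ)|) +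
          keyWeight (P.exps v) q * (((q : ℝ) - 1) ^ 2 * |cellModel aA aB aC P q v - cellModel aA' aB' aC' P q v|) +
          keyWeight (P.exps v) q *
          (∑ r ∈ range q, ∑ s ∈ range q, ∑ z ∈ range q, |intensity G P q (mkDatum (Pos.exps P v) r s z) - ite (Pos.adm P q r s z = true) ((if q ≤ yb ∧ q ^ (v + 1) ≤ Y then cellModel aA' aB' aC' P q v else 0)) (0 : ℝ)|)) :=
        Finset.sum_le_sum fun q hq => Finset.sum_le_sum fun v _ => by
          have hq1 := (prime_of_mem_oddPrimesBelow hq).one_le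
          set mF : ℝ := (if q ≤ yb ∧ q ^ (v + 1) ≤ Y then cellModel aA aB aC P q v else 0) with hmF
          set mG : ℝ := (if q ≤ yb ∧ q ^ (v + 1) ≤ Y then cellModel aA' aB' aC' P q v else 0) with hmG
          have ht : |mF - mG| ≤ |cellModel aA aB aC P q v - cellModel aA' aB' aC' P q v| := by
            rw [hmF, hmG]
            split_ifs <;> simp
          have hFm := abs_cellMass_sub_le F P hq1 v mF
          have hGm := abs_cellMass_sub_le G P hq1 v mG
          have h3 := abs_sub_le (cellMass F P q v) (((q : ℝ) - 1) ^ 2 * mF) (cellMass G P q v)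
          have h4 := abs_sub_le (((q : ℝ) - 1) ^ 2 * mF) (((q : ℝ) - 1) ^ 2 * mG) (cellMass G P q v)
          rw [← mul_sub, abs_mul, abs_of_nonneg (sq_nonneg ((q : ℝ) - 1))] at h4
          rw [abs_sub_comm] at hGm
          rw [← mul_add, ← mul_add]
          exact mul_le_mul_of_nonneg_left
            (by linarith [mul_le_mul_of_nonneg_left ht (sq_nonneg ((q : ℝ) - 1))]) (keyWeight_nonneg _ _)
    _ ≤ 24 * e₁ * Lc + 2 * e + C := by
        simp only [Finset.sum_add_distrib]
        linarith

end CellLawsBook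

/-- **Registered stub `stub_keyCells_of_cellLawsLog`** (line `grh-friable-cell-resolution` of crux stmt-ABC-14354):
ENGINE OUTPUT (logarithmic interface) ⟹ KEY-CELL STRUCTURE.  Given `⟨V₀, A₀, h⟩ := CellLawsPackage₂ (1/4)` and the
tilt constant `C_T`, for `δ > 0` and `N₁` invoke `h` with the tail precision `e := 1` at depth
`max N₁ (⌈2 C_T/δ⌉₊ + ⌈(48 A₀ + 4)/δ⌉₊)`; the five families and the shape clauses are reused verbatim, the fifteen (CE)
clauses are `CellLawsBook.ce_bound₂` and the nine (VM) clauses `CellLawsBook.vm_bound₂` (the models of a compared pair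
agree at the compared position by the package's exponent assignment, so that `TiltBound` bounds the tilt term), and
`24 e₁ Lc + 2 + C_T ≤ 24 A₀ + 2 + C_T ≤ δN` by `e₁ Lc ≤ A₀` and the choice of `N`. [folklore] -/
theorem stub_keyCells_of_cellLawsLog : CellLawsPackage₂ (1 / 4) → TiltBound → KeyCellStructure (1 / 4) := by
  rintro ⟨V₀, A₀, hP⟩ ⟨C_T, hT⟩
  refine ⟨V₀, fun δ hδ N₁ => ?_⟩
  obtain ⟨N, hN, FA, FB, FC, G, G', α, α', yb, Y, e₁, Lc, hα, hα', he₁, he₁2, hA₀, hshape, ⟨sA, sB, sC, sG, sG'⟩,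
      ⟨fA, fB, fC, fG, fG'⟩, ⟨iA, iB, iC, iG, iG'⟩, ⟨lA, lB, lC, lG, lG'⟩, ⟨tA, tB, tC, tG, tG'⟩, -⟩ :=
    hP 1 one_pos (max N₁ (⌈2 * C_T / δ⌉₊ + ⌈(48 * A₀ + 4) / δ⌉₊))
  obtain ⟨hFA0, hFB0, hFC0, hG0, hG'0, hFA, hFB, hFC, hG, hG'⟩ := hshape
  have hN' : ⌈2 * C_T / δ⌉₊ + ⌈(48 * A₀ + 4) / δ⌉₊ ≤ N := (le_max_right _ _).trans hN
  have hCT : 2 * C_T ≤ δ * N := by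
    have h2 : 2 * C_T / δ ≤ N := (Nat.le_ceil _).trans (by exact_mod_cast (by omega : ⌈2 * C_T / δ⌉₊ ≤ N))
    rwa [div_le_iff₀' hδ] at h2
  have hAN : 48 * A₀ + 4 ≤ δ * N := by
    have h2 : (48 * A₀ + 4) / δ ≤ N :=
      (Nat.le_ceil _).trans (by exact_mod_cast (by omega : ⌈(48 * A₀ + 4) / δ⌉₊ ≤ N))
    rwa [div_le_iff₀' hδ] at h2
  -- the budget: `24e₁Lc + 2 + C ≤ δN` whenever `2C ≤ δN`
  have hbud : ∀ C : ℝ, 2 * C ≤ δ * N → 24 * e₁ * Lc + 2 * 1 + C ≤ δ * N := by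
    intro C hC
    have h24 : 24 * e₁ * Lc ≤ 24 * A₀ := by
      rw [mul_assoc]
      exact mul_le_mul_of_nonneg_left hA₀ (by norm_num)
    linarith
  have hB := hbud C_T hCT
  have hB0 : 24 * e₁ * Lc + 2 * 1 ≤ δ * N := by linarith [hbud 0 (by rw [mul_zero]; positivity)]
  have he0 : 0 ≤ e₁ := he₁.le
  -- the cell laws of the five families (abc-triples by `IsBalanced`)
  have cA := And.intro hFA0 (And.intro (fun T h => (hFA T h).1.1) (And.intro sA (And.intro fA (And.intro iA (And.intro lA tA)))))
  have cB := And.intro hFB0 (And.intro (fun T h => (hFB T h).1.1) (And.intro sB (And.intro fB (And.intro iB (And.intro lB tB)))))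
  have cC := And.intro hFC0 (And.intro (fun T h => (hFC T h).1.1) (And.intro sC (And.intro fC (And.intro iC (And.intro lC tC)))))
  have cG := And.intro hG0 (And.intro (fun T h => (hG T h).1.1) (And.intro sG (And.intro fG (And.intro iG (And.intro lG tG)))))
  have cG' := And.intro hG'0 (And.intro (fun T h => (hG' T h).1.1) (And.intro sG' (And.intro fG' (And.intro iG' (And.intro lG' tG')))))
  refine ⟨N, (le_max_left _ _).trans hN, FA, FB, FC, G, G', hFA0, hFB0, hFC0, hG0, hG'0, hFA, hFB, hFC, hG, hG',
    fun P Q V => ⟨(ce_bound₂ he0 he₁2 cA P Q V).trans hB0, (ce_bound₂ he0 he₁2 cB P Q V).trans hB0,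
      (ce_bound₂ he0 he₁2 cC P Q V).trans hB0, (ce_bound₂ he0 he₁2 cG P Q V).trans hB0,
      (ce_bound₂ he0 he₁2 cG' P Q V).trans hB0⟩, fun Q V => ?_⟩
  exact ⟨(vm_bound₂ he0 he₁2 cA cG' Pos.A Q V (hT _ _ _ _ _ _ Pos.A hα' hα hα hα' hα' hα' rfl Q V)).trans hB,
    (vm_bound₂ he0 he₁2 cA cG Pos.B Q V (hT _ _ _ _ _ _ Pos.B hα' hα hα hα hα hα rfl Q V)).trans hB,
    (vm_bound₂ he0 he₁2 cA cG Pos.C Q V (hT _ _ _ _ _ _ Pos.C hα' hα hα hα hα hα rfl Q V)).trans hB,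
    (vm_bound₂ he0 he₁2 cB cG Pos.A Q V (hT _ _ _ _ _ _ Pos.A hα hα' hα hα hα hα rfl Q V)).trans hB,
    (vm_bound₂ he0 he₁2 cB cG' Pos.B Q V (hT _ _ _ _ _ _ Pos.B hα hα' hα hα' hα' hα' rfl Q V)).trans hB,
    (vm_bound₂ he0 he₁2 cB cG Pos.C Q V (hT _ _ _ _ _ _ Pos.C hα hα' hα hα hα hα rfl Q V)).trans hB,
    (vm_bound₂ he0 he₁2 cC cG Pos.A Q V (hT _ _ _ _ _ _ Pos.A hα hα hα' hα hα hα rfl Q V)).trans hB,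
    (vm_bound₂ he0 he₁2 cC cG Pos.B Q V (hT _ _ _ _ _ _ Pos.B hα hα hα' hα hα hα rfl Q V)).trans hB,
    (vm_bound₂ he0 he₁2 cC cG' Pos.C Q V (hT _ _ _ _ _ _ Pos.C hα hα hα' hα' hα' hα' rfl Q V)).trans hB⟩

end Summit.ABC.ABC.Theorems.TameLocalReceptacle

end
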